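import Literature.NumberTheory.GaloisRepresentations.InducedGaloisRep
import Literature.NumberTheory.GaloisRepresentations.CliffordTwistOfRestriction
import Literature.RepresentationTheory.Semisimple.IrreducibleOfCharpoly
import HarnessLib

/-!
# The induced representation of a restriction, `Ind_N^G (s|_N)`, is reducible (index `> 1`)

Topic `NumberTheory/GaloisRepresentations`; namespace
`Literature.NumberTheory.GaloisRepresentations`.  Theorems only: **no definition and no named
fact is introduced**.

Let `φ : H → G` be an open embedding of topological groups with image `N` of finite index,
`t : ι → G` a transversal of `G / N` and `s : G →ₜ* GL_m(A)` a framed representation of the BIG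
group.  The induced representation `Ind_N^G (s ∘ φ)` of the restriction of `s`
(`FramedRep.induce`, matrix form `(ṡ(tᵢ⁻¹ g tⱼ))ᵢⱼ` of Serre §3.3) is
`s ⊗ Ind_N^G 1 = s ⊗ (permutation representation of G on G / N)` (Serre §3.3 Examples 2 and 5),
and the permutation representation contains the unit representation (the constant functions,
Serre §2.3 Ex. 2.6 (a)); so `Ind_N^G (s ∘ φ)` contains a copy of `s`, of rank `m < [G : N] · m`.
Concretely:

* `indMatrix_mul_blockConst_of_extends` — the block column `C = (s(t_k)⁻¹)_k` (all block
  columns equal) satisfies `Ind(s ∘ φ)(g) · C = C · diag(s(g), …, s(g))`: block row `i` of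
  `Ind(s ∘ φ)(g)` has exactly one non-zero block, at the `k` with `tᵢ⁻¹ g t_k ∈ N`, equal to
  `s(tᵢ)⁻¹ s(g) s(t_k)`.
* `FramedRep.not_isIrreducible_induce_comp` — hence the column space `U` of the flattened `C` is
  a subrepresentation of `Ind(s ∘ φ)`; it is non-zero as soon as `m > 0` (the blocks `s(t_k)⁻¹` are
  invertible) and proper as soon as `ι` has two elements (`C` has two equal columns, so it is not
  invertible); and a rank-`0` representation is not irreducible either.  So `Ind(s ∘ φ)` is NOT
  irreducible.
* `not_isIrreducible_of_charpoly_eq_induce_restrictField` — **Galois form.**  For a Galois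
  extension of number fields `L/K` with `[L : K] > 1`, framed Galois representations
  `r : Γ_K → GL_n(A)`, `s : Γ_K → GL_m(A)` over an algebraically closed field `A` of
  characteristic `0` with `det(X - r(x)) = det(X - Ind_{Γ_L}^{Γ_K}(s|_{Γ_L})(x))` for all `x ∈ Γ_K`
  (`FramedGaloisRep.induce`, `restrictField`), `r` is NOT irreducible: comparing degrees
  `n = [L : K] · m`, irreducibility only depends on the characteristic polynomials
  (`Literature.RepresentationTheory.Semisimple.isIrreducible_of_charpoly_eq`, Brauer–Nesbitt), and
  `Ind(s|_{Γ_L})` is reducible by the previous result.  This is the Galois side of "the cuspidal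
  representation `π_s` attached to `s` is not Galois-stable" in the descent of reciprocity along a
  cyclic layer `L/K` (an irreducible `ρ ≅ Ind_{Γ_L}^{Γ_K} s` forces `s` not to extend to `Γ_K`).

## References

* J.-P. Serre, *Linear representations of finite groups*, GTM 42 (1977), §3.3 (Examples 2, 5;
  Thm. 12 and its proof: the matrix form), §2.3 Ex. 2.6 (a). [SerreLinearRepresentations1977]
* N. Bourbaki, *Algèbre*, Ch. VIII (2012), § 20 n° 6, Thm. 2, Cor. 1 (Brauer–Nesbitt).
  [BourbakiAlgebreVIII2012]
-/

noncomputable section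

open Topology Matrix Field

namespace Literature.NumberTheory.GaloisRepresentations

universe u u' v

/-! ### The block identity `Ind(s ∘ φ)(g) · C = C · diag(s(g))` -/

section IndMatrix

variable {H G R : Type*} [Group H] [Group G] [Semiring R] {ι : Type*} [Fintype ι] [DecidableEq ι]

/-- **`Ind_N^G` of a restriction: the copy of `s` inside `Ind(s|_N)`.**  Let `φ : H →* G` be
injective, `σ : G →* R` a homomorphism of the big group, `π = σ ∘ φ` its restriction and
`r : ι → G` a transversal of `G / φ(H)`.  For the block matrix `C = (σ(r_k)⁻¹)_{k, j}` (all block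
columns equal), `Ind(π)(g) · C = C · diag(σ(g), …, σ(g))`: block row `i` of `Ind(π)(g)`
(`indMatrix`) has exactly one non-zero block, at the unique `k` with `rᵢ⁻¹ g r_k ∈ φ(H)`, where it
is `σ(rᵢ⁻¹ g r_k) = σ(rᵢ)⁻¹ σ(g) σ(r_k)`.  (This is `Ind(Res σ) ≅ σ ⊗ Ind(1)` restricted to the
constant functions of the permutation representation `Ind(1)`.)
[cite: SerreLinearRepresentations1977, §3.3 Examples 2, 5] -/
theorem indMatrix_mul_blockConst_of_extends {φ : H →* G} (hφ : Function.Injective φ)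
    {π : H →* R} {σ : G →* R} (hπ : ∀ h, π h = σ (φ h)) {r : ι → G}
    (hr : Function.Bijective fun i => (r i : G ⧸ φ.range)) (g : G) :
    indMatrix φ π r g * Matrix.of (fun k (_ : ι) => σ (r k)⁻¹) =
      Matrix.of (fun k (_ : ι) => σ (r k)⁻¹) * Matrix.diagonal fun _ => σ g := by
  ext i j
  rw [Matrix.mul_apply, Matrix.mul_diagonal]
  simp only [Matrix.of_apply, indMatrix_apply]
  obtain ⟨k₀, hk₀⟩ := hr.2 ((g⁻¹ * r i : G) : G ⧸ φ.range)
  have hk₀' : (r k₀ : G ⧸ φ.range) = (g⁻¹ * r i : G) := hk₀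
  have hmem : (r i)⁻¹ * g * r k₀ ∈ φ.range := by
    have h1 : (g⁻¹ * r i)⁻¹ * r k₀ ∈ φ.range := QuotientGroup.eq.mp hk₀'.symm
    rwa [_root_.mul_inv_rev, inv_inv] at h1
  rw [Finset.sum_eq_single k₀]
  · obtain ⟨h, hh⟩ := hmem
    rw [← hh, dotExtend_apply_map hφ, hπ, hh, ← map_mul, ← map_mul]
    congr 1
    group
  · intro k _ hk
    rw [dotExtend_of_not_mem φ _ ?_, zero_mul]
    intro hmemk
    refine hk (hr.1 ?_)
    change (r k : G ⧸ φ.range) = (r k₀ : G ⧸ φ.range)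
    rw [hk₀', eq_comm, QuotientGroup.eq, _root_.mul_inv_rev, inv_inv]
    exact hmemk
  · intro h
    exact absurd (Finset.mem_univ k₀) h

end IndMatrix

/-! ### `Ind_N^G (s ∘ φ)` is not irreducible -/

section Framed

variable {H : Type u'} {G : Type u} [Group H] [TopologicalSpace H] [Group G] [TopologicalSpace G]
  [IsTopologicalGroup G] {A : Type v} [Field A] [TopologicalSpace A] {n m : ℕ}
  {ι : Type*} [Fintype ι] [DecidableEq ι]

/-- **The induced representation of a restriction is not irreducible** (index `> 1`).  Let
`φ : H →ₜ* G` be an open embedding of topological groups, `r : ι → G` a transversal of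
`G / φ(H)` with `ι` having two distinct elements, `e : ι × Fin m ≃ Fin n`, and `s : G →ₜ* GL_m(A)`
a framed representation of `G` over a field.  Then `Ind_{φ(H)}^G (s ∘ φ)` (`FramedRep.induce`) is
NOT irreducible: if `m = 0` it has rank `0`; otherwise the column space of the flattened block
column `C = (s(r_k)⁻¹)_k` is a subrepresentation (`indMatrix_mul_blockConst_of_extends`:
`Ind(g) · C = C · diag(s(g))`), non-zero (`s(r_k)⁻¹ ≠ 0`) and proper (`C` has two equal columns,
hence is not surjective).  Abstractly: `Ind(Res s) ≅ s ⊗ Ind(1) ⊇ s ⊗ 1`.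
[cite: SerreLinearRepresentations1977, §3.3 Examples 2, 5; §2.3 Ex. 2.6 (a)] -/
theorem FramedRep.not_isIrreducible_induce_comp (φ : H →ₜ* G) (hφ : IsOpenEmbedding φ)
    (r : ι → G) (hr : Function.Bijective fun i => (r i : G ⧸ φ.toMonoidHom.range))
    (e : ι × Fin m ≃ Fin n) (s : FramedRep G A m) {i₀ i₁ : ι} (hι : i₀ ≠ i₁) :
    ¬ (FramedRep.induce φ.toMonoidHom hφ r hr e (s.comp φ)).IsIrreducible := by
  classical
  intro hirr
  -- flattening of block matrices, the block column `C = (s(r_k)⁻¹)_{k, j}`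
  set ψ : Matrix ι ι (Matrix (Fin m) (Fin m) A) ≃+* Matrix (Fin n) (Fin n) A :=
    (Matrix.compRingEquiv ι (Fin m) A).trans (Matrix.reindexRingEquiv A e) with hψ
  have hψapply : ∀ (M : Matrix ι ι (Matrix (Fin m) (Fin m) A)) (x y : Fin n),
      ψ M x y = M (e.symm x).1 (e.symm y).1 (e.symm x).2 (e.symm y).2 := fun _ _ _ => rfl
  set C : Matrix ι ι (Matrix (Fin m) (Fin m) A) :=
    Matrix.of fun k (_ : ι) => FramedRep.toMatrixHom s (r k)⁻¹ with hC
  set ind : FramedRep G A n := FramedRep.induce φ.toMonoidHom hφ r hr e (s.comp φ) with hind_def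
  have hind : ∀ g : G, ((ind g : GL (Fin n) A) : Matrix (Fin n) (Fin n) A) =
      ψ (indMatrix φ.toMonoidHom (FramedRep.toMatrixHom (s.comp φ)) r g) := fun g => rfl
  have hπ : ∀ h : H, FramedRep.toMatrixHom (s.comp φ) h = FramedRep.toMatrixHom s (φ.toMonoidHom h) :=
    fun h => rfl
  have key0 : ∀ g : G, indMatrix φ.toMonoidHom (FramedRep.toMatrixHom (s.comp φ)) r g * C =
      C * Matrix.diagonal fun _ => FramedRep.toMatrixHom s g := fun g =>
    indMatrix_mul_blockConst_of_extends hφ.injective hπ hr g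
  have key : ∀ g : G, ((ind g : GL (Fin n) A) : Matrix (Fin n) (Fin n) A) * ψ C =
      ψ C * ψ (Matrix.diagonal fun _ => FramedRep.toMatrixHom s g) := fun g => by
    rw [hind, ← map_mul, ← map_mul, key0 g]
  -- ranks: `0 < n`, hence `0 < m`
  have hn : 0 < n := hirr.rank_pos
  have hm : 0 < m := by
    rcases Nat.eq_zero_or_pos m with h0 | h0
    · exfalso
      subst h0
      have h1 := Fintype.card_congr e
      rw [Fintype.card_prod, Fintype.card_fin, Fintype.card_fin, mul_zero] at h1
      omega
    · exact h0
  haveI : Nonempty (Fin m) := ⟨⟨0, hm⟩⟩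
  -- the subrepresentation `U = C' (A^n)`
  set U : Submodule A (Fin n → A) := LinearMap.range (Matrix.toLin' (ψ C)) with hU_def
  let W : Subrepresentation ind.toRepresentation := ⟨U, fun g v hv => by
    obtain ⟨w, rfl⟩ := LinearMap.mem_range.mp hv
    rw [FramedRep.toRepresentation_apply_apply, Matrix.toLin'_apply, Matrix.mulVec_mulVec, key g,
      ← Matrix.mulVec_mulVec]
    exact LinearMap.mem_range.mpr ⟨_, Matrix.toLin'_apply _ _⟩⟩
  haveI : IsSimpleOrder (Subrepresentation ind.toRepresentation) := hirr
  rcases IsSimpleOrder.eq_bot_or_eq_top W with hbot | htop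
  · -- `W = ⊥`: then `C' = 0`, `C = 0`, `s(r_{i₀})⁻¹ = 0`
    have hU : U = ⊥ := congrArg Subrepresentation.toSubmodule hbot
    have hC0 : C = 0 := by
      have h1 : Matrix.toLin' (ψ C) = 0 := LinearMap.range_eq_bot.mp hU
      have h2 : ψ C = 0 := (LinearEquiv.map_eq_zero_iff Matrix.toLin').mp h1
      exact ψ.map_eq_zero_iff.mp h2
    have h3 : C i₀ i₀ = 0 := by
      rw [hC0]
      rfl
    rw [hC, Matrix.of_apply, FramedRep.toMatrixHom_apply] at h3
    exact Units.ne_zero _ h3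
  · -- `W = ⊤`: then `C'` is surjective, hence invertible; but it has two equal columns
    have hU : U = ⊤ := congrArg Subrepresentation.toSubmodule htop
    have hsurj : Function.Surjective (ψ C).mulVec := by
      intro v
      obtain ⟨w, hw⟩ := LinearMap.range_eq_top.mp hU v
      exact ⟨w, by rw [← Matrix.toLin'_apply]; exact hw⟩
    have hunit : IsUnit (ψ C).det :=
      (Matrix.isUnit_iff_isUnit_det _).mp (Matrix.mulVec_surjective_iff_isUnit.mp hsurj)
    refine hunit.ne_zero (Matrix.det_zero_of_column_eq (i := e (i₀, ⟨0, hm⟩))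
      (j := e (i₁, ⟨0, hm⟩)) (fun h => hι (congrArg Prod.fst (e.injective h))) fun x => ?_)
    rw [hψapply, hψapply, Equiv.symm_apply_apply, Equiv.symm_apply_apply]
    rfl

end Framed

/-! ### Galois form -/

section Galois

/-- **An irreducible Galois representation never has the characteristic polynomials of
`Ind_{Γ_L}^{Γ_K}(s|_{Γ_L})` when `[L : K] > 1`.**  Let `L/K` be a Galois extension of number fields
with `1 < [L : K]`, `A` an algebraically closed topological field of characteristic zero, and
`r : Γ_K → GL_n(A)`, `s : Γ_K → GL_m(A)` framed Galois representations with
`det(X - r(x)) = det(X - Ind_{Γ_L}^{Γ_K}(s|_{Γ_L})(x))` for every `x ∈ Γ_K`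
(`FramedGaloisRep.induce`, `FramedGaloisRep.restrictField`).  Then `r` is NOT irreducible:
comparing degrees `n = [L : K] · m`; irreducibility of a matrix representation only depends on
its characteristic polynomials (Brauer–Nesbitt,
`Literature.RepresentationTheory.Semisimple.isIrreducible_of_charpoly_eq`), and
`Ind_{Γ_L}^{Γ_K}(s|_{Γ_L}) ≅ s ⊗ Ind(1)` contains the copy `s ⊗ 1` of `s`
(`FramedRep.not_isIrreducible_induce_comp`).  Galois side of the descent of reciprocity along a
cyclic layer: if an irreducible `ρ ≅ Ind_{Γ_L}^{Γ_K} s`, then `s` does not extend to `Γ_K`.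
[cite: SerreLinearRepresentations1977, §3.3 Examples 2, 5; §2.3 Ex. 2.6 (a)]
[cite: BourbakiAlgebreVIII2012, VIII § 20 n° 6, Thm. 2, Cor. 1] -/
theorem not_isIrreducible_of_charpoly_eq_induce_restrictField :
    ∀ (K L : Type) [Field K] [NumberField K] [Field L] [NumberField L] [Algebra K L]
      [IsGalois K L], 1 < Module.finrank K L →
      ∀ {A : Type} [Field A] [TopologicalSpace A] [IsTopologicalRing A] [IsAlgClosed A]
        [CharZero A] {n m : ℕ}
        (r : Literature.NumberTheory.GaloisRepresentations.FramedGaloisRep K A n)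
        (s : Literature.NumberTheory.GaloisRepresentations.FramedGaloisRep K A m),
        (∀ x : Field.absoluteGaloisGroup K,
          Literature.NumberTheory.GaloisRepresentations.FramedRep.charpoly r x =
            Literature.NumberTheory.GaloisRepresentations.FramedRep.charpoly
              ((s.restrictField L).induce K (rfl : Module.finrank K L = Module.finrank K L)) x) →
        ¬ Literature.NumberTheory.GaloisRepresentations.FramedRep.IsIrreducible r := by
  intro K L _ _ _ _ _ _ hd A _ _ _ _ _ n m r s hchar hirr
  -- degrees: `n = [L : K] · m`
  obtain rfl : n = Module.finrank K L * m := by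
    have h := congrArg Polynomial.natDegree (hchar 1)
    simp only [FramedRep.charpoly, Matrix.charpoly_natDegree_eq_dim, Fintype.card_fin] at h
    exact h
  -- `Ind(s|_{Γ_L})` has the characteristic polynomials of the irreducible `r`, so is irreducible
  have hind : FramedRep.IsIrreducible ((s.restrictField L).induce K rfl) :=
    Literature.RepresentationTheory.Semisimple.isIrreducible_of_charpoly_eq
      (FramedGaloisRep.induce K rfl (s.restrictField L)).toMonoidHom r.toMonoidHom
      (fun g => (hchar g).symm) hirr
  -- two distinct cosets
  obtain ⟨i₀, i₁, hne⟩ : ∃ i₀ i₁ : Fin (Module.finrank K L), i₀ ≠ i₁ :=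
    ⟨⟨0, by omega⟩, ⟨1, hd⟩, fun h => absurd (congrArg Fin.val h) (by simp)⟩
  exact FramedRep.not_isIrreducible_induce_comp (absGaloisRestrict K L)
    (isOpenEmbedding_absGaloisRestrict K L) (absGaloisCosetRep K L rfl)
    (absGaloisCosetRep_bijective K L rfl) finProdFinEquiv s hne hind

end Galois

end Literature.NumberTheory.GaloisRepresentations

end
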